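import Summits.SmoothPoincare4.SmoothPoincare4.Theorems.SymplecticOrigamiGromovRecognitionRelEndStubTameMoserAux2
import Summits.SmoothPoincare4.SmoothPoincare4.Theorems.SymplecticOrigamiGromovRecognitionRelEndStubTameMoserAux4
import Literature.Geometry.Symplectic.AlmostComplexStructure
import Literature.Geometry.Symplectic.GromovR4StdModel
import HarnessLib

/-!
# Stub `stub_tameMoser` of line `cross-cap-laurent` — compactly supported tame Moser
(crux `SymplecticOrigami.GromovRecognitionRelEnd` ≡ `SymplecticCap.GromovRecognitionRelEnd` ≡
`Literature.Geometry.Symplectic.gromov_recognitionR4_relEnd`, item stmt-SmoothPoincare4-11009)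

The last of the six registered stubs of the line: its conclusion is the conclusion of the crux.
**Statement.** On a smooth 4-manifold `M` let `sf` be a smooth closed `2`-form, `Φ : M ≃ₘ ℝ⁴` a
diffeomorphism equal to `ψ` off a compact set `K` with `sf = ψ*ω₀` off `K`, and `J` an almost
complex structure tamed both by `sf` and by `Φ*ω₀`. Then some `Φ' : M ≃ₘ ℝ⁴` satisfies
`sf = Φ'*ω₀` everywhere and `Φ' = ψ` off a compact set (`stub_tameMoser`).

**Proof** (McDuff–Salamon (2017), §3.2, Moser's trick; Wendl (2018), proof of Thm. 6.8, p. 139,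
made relative): transport everything to `ℝ⁴` by `Φ` — `ω₁ = (Φ⁻¹)*sf` is a smooth closed Mathlib
`2`-form on `ℝ⁴` which equals `ω₀` off the compact `Φ(K)` (`K` is closed, so `dΦ = dψ` on the
open `Kᶜ`) and such that every `(1 − t) ω₁ + t ω₀`, `t ∈ [0, 1]`, is nondegenerate (both tame the
transported `J`: convexity of the tame cone); `ω₀ − ω₁ = dβ` with `β` compactly supported
(`…StubTameMoserAux2`, `H²_c(ℝ⁴) = 0`); the compactly supported Moser isotopy of
`…StubTameMoserAux4` gives `ρ : ℝ⁴ ≃ₘ ℝ⁴`, `ρ = id` off a ball, with `ρ*ω₀ = ω₁`; then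
`Φ' = ρ ∘ Φ` and `K' = K ∪ Φ⁻¹(ball)`.

Everything is proved; no definition, no named fact.

References: D. McDuff, D. Salamon, *Introduction to Symplectic Topology*, 3rd ed. (2017), §3.2
[McDuffSalamon2017]; C. Wendl, *Holomorphic Curves in Low Dimensions* (2018), Thm. 6.8
[Wendl2018].
-/

noncomputable section

-- the prescribed namespace `Summit.<P>.<Sub>.…` duplicates `SmoothPoincare4` (P = Sub)
set_option linter.dupNamespace false

open scoped Manifold ContDiff Topology
open Set TopologicalSpace Literature.Geometry.Kaehler Literature.Geometry.Symplectic

namespace Summit.SmoothPoincare4.SmoothPoincare4.Theorems.GromovRecognitionRelEnd.CrossCapLaurent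

/-- Model space `ℝ⁴ = ℂ²` (coordinates `0,1` = `z₁`, `2,3` = `z₂`). -/
local notation "E4" => EuclideanSpace ℝ (Fin 4)
/-- `ℝ² = ℂ`, the coordinate plane of one factor. -/
local notation "E2" => EuclideanSpace ℝ (Fin 2)

/-! ## Forms on the model space: smoothness and closedness in Mathlib's vocabulary -/

section Flat

variable {F : Type*} [NormedAddCommGroup F] [NormedSpace ℝ F] {k : ℕ}

/-- On the model space `ℝ⁴` the chart representative of a form is the form itself. [folklore] -/
theorem inChart_flat (α : MForm (𝓡 4) E4 F k) (x : E4) : α.inChart x = α := by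
  funext y
  ext v
  simp [MForm.inChart_apply]
  rfl

/-- **A chart-wise smooth form on the model space `ℝ⁴` is `C^∞` as a map into the space of
alternating maps** (the charts are the identity). [folklore] -/
theorem contDiff_of_isSmoothForm_flat {α : MForm (𝓡 4) E4 F k} (h : IsSmoothForm α) :
    ContDiff ℝ (F := E4 [⋀^Fin k]→L[ℝ] F) ∞ α := by
  refine contDiff_iff_contDiffAt.2 fun x ↦ ?_
  have hx := h x
  rw [inChart_flat] at hx
  simp only [extChartAt, OpenPartialHomeomorph.extend, chartAt_self_eq,
    OpenPartialHomeomorph.refl_partialEquiv, modelWithCornersSelf_partialEquiv,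
    PartialEquiv.refl_trans, PartialEquiv.refl_coe, id_eq, modelWithCornersSelf_coe, range_id] at hx
  exact hx.contDiffAt Filter.univ_mem

/-- A closed form on the model space `ℝ⁴` has vanishing Mathlib exterior derivative
(`mextDeriv_eq_extDeriv`). [folklore] -/
theorem extDeriv_eq_zero_of_isClosedForm_flat {α : MForm (𝓡 4) E4 F k} (h : IsClosedForm α) :
    extDeriv α = 0 := by
  funext x
  have h1 := mextDeriv_eq_extDeriv α x
  have h2 : mextDeriv α x = 0 := by rw [show mextDeriv α = 0 from h]; rfl
  rw [h2] at h1
  exact h1.symm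

end Flat

/-- A `2`-form is determined by its values on pairs `![v, w]`. [folklore] -/
theorem twoForm_ext {V F : Type*} [NormedAddCommGroup V] [NormedSpace ℝ V] [NormedAddCommGroup F]
    [NormedSpace ℝ F] {A B : V [⋀^Fin 2]→L[ℝ] F} (h : ∀ v w, A ![v, w] = B ![v, w]) : A = B := by
  ext u
  have hu : u = ![u 0, u 1] := by funext i; fin_cases i <;> rfl
  rw [hu]
  exact h _ _

/-- Convexity of the tame cone, pointwise: a convex combination of two positive numbers is
nonzero (Wendl (2018), p. 139). [folklore] -/
theorem convex_comb_ne_zero {a b t : ℝ} (ha : 0 < a) (hb : 0 < b) (ht0 : 0 ≤ t) (ht1 : t ≤ 1) :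
    (1 - t) * a + t * b ≠ 0 := by
  rcases eq_or_lt_of_le ht1 with rfl | hlt
  · simpa using hb.ne'
  · have : 0 < (1 - t) * a := mul_pos (by linarith) ha
    nlinarith [mul_nonneg ht0 hb.le]


/-! ## Transport along a diffeomorphism `M ≃ₘ ℝ⁴` -/

section Transport

variable {M : Type} [TopologicalSpace M] [ChartedSpace E4 M]

/-- Evaluation of a `2`-form at equal base points on equal coordinate vectors (the tangent spaces
of a manifold modelled on `ℝ⁴` are all `ℝ⁴`). [folklore] -/
theorem mform_apply_congr_point (sf : MForm (𝓡 4) M ℝ 2) {x x' : M} (h : x' = x) (v w : E4) :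
    sf x' ![v, w] = sf x ![v, w] := by
  subst h
  rfl

/-- `dΦ ∘ dΦ⁻¹ = id` for a diffeomorphism `Φ : M ≃ₘ ℝ⁴` (chain rule on `Φ ∘ Φ⁻¹ = id`).
[folklore] -/
theorem mfderiv_apply_mfderiv_symm (Φ : M ≃ₘ⟮𝓡 4, 𝓡 4⟯ E4) (y : E4) (a : E4) :
    mfderiv (𝓡 4) (𝓡 4) Φ (Φ.symm y) (mfderiv (𝓡 4) (𝓡 4) Φ.symm y a) = a := by
  have hn : (∞ : WithTop ℕ∞) ≠ 0 := by simp
  have hc := mfderiv_comp y (Φ.mdifferentiable hn (Φ.symm y)) (Φ.symm.mdifferentiable hn y)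
  have hid : ((Φ : M → E4) ∘ (Φ.symm : E4 → M)) = id := funext fun z ↦ Φ.apply_symm_apply z
  rw [hid, mfderiv_id] at hc
  have h := (ContinuousLinearMap.ext_iff.1 hc a).symm
  exact h

/-- `dΦ⁻¹ ∘ dΦ = id` for a diffeomorphism `Φ : M ≃ₘ ℝ⁴` (chain rule on `Φ⁻¹ ∘ Φ = id`).
[folklore] -/
theorem mfderiv_symm_apply_mfderiv (Φ : M ≃ₘ⟮𝓡 4, 𝓡 4⟯ E4) (x : M) (v : TangentSpace (𝓡 4) x) :
    mfderiv (𝓡 4) (𝓡 4) Φ.symm (Φ x) (mfderiv (𝓡 4) (𝓡 4) Φ x v) = v := by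
  have hn : (∞ : WithTop ℕ∞) ≠ 0 := by simp
  have hc := mfderiv_comp x (Φ.symm.mdifferentiable hn (Φ x)) (Φ.mdifferentiable hn x)
  have hid : ((Φ.symm : E4 → M) ∘ (Φ : M → E4)) = id := funext fun z ↦ Φ.symm_apply_apply z
  rw [hid, mfderiv_id] at hc
  have h := (ContinuousLinearMap.ext_iff.1 hc v).symm
  exact h

/-- `dΦ⁻¹_y ∘ dΦ_{Φ⁻¹ y} = id`, the previous identity based at `y = Φ x`. [folklore] -/
theorem mfderiv_symm_apply_mfderiv' (Φ : M ≃ₘ⟮𝓡 4, 𝓡 4⟯ E4) (y : E4)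
    (w : TangentSpace (𝓡 4) (Φ.symm y)) :
    mfderiv (𝓡 4) (𝓡 4) Φ.symm y (mfderiv (𝓡 4) (𝓡 4) Φ (Φ.symm y) w) = w := by
  have h := mfderiv_symm_apply_mfderiv Φ (Φ.symm y) w
  rw [Φ.apply_symm_apply] at h
  exact h

end Transport

/-! ## The stub -/

/-- **Stub 6 — compactly supported TAME Moser, relative to the end** (card S6 `SplitTaming` + S7
`CompactMoserR4`; Wendl 2018 p. 139 last paragraph made relative, McDuff–Salamon 2017 §3.2
Moser's trick). `sf` smooth closed, `Φ : M ≃ₘ ℝ⁴` a diffeomorphism equal to `ψ` off the compact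
`K`, `sf = ψ*ω₀` off `K`, and an almost complex structure `J` tamed both by `sf` and by `Φ*ω₀`;
then some `Φ' : M ≃ₘ ℝ⁴` has `sf = Φ'*ω₀` everywhere and `Φ' = ψ` off a compact set. Proof:
transport to `ℝ⁴` by `Φ` (`ω₁ = (Φ⁻¹)*sf`, smooth, closed, `= ω₀` off `Φ(K)`, the segment to `ω₀`
nondegenerate by tameness), `ω₀ − ω₁ = dβ` with `β` compactly supported
(`exists_extDeriv_eq_hasCompactSupport'`, `H²_c(ℝ⁴) = 0`), compactly supported Moser isotopy
`ρ` with `ρ*ω₀ = ω₁`, `ρ = id` off a ball (`moser_compactSupport`); `Φ' = ρ ∘ Φ`,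
`K' = K ∪ Φ⁻¹(B̄)`. [cite: McDuffSalamon2017, §3.2 (Moser); Wendl2018, proof of Thm 6.8, p. 139] -/
theorem stub_tameMoser :
    ∀ (M : Type) [TopologicalSpace M] [T2Space M] [SecondCountableTopology M]
      [ChartedSpace E4 M] [IsManifold (𝓡 4) ∞ M]
      (sf : MForm (𝓡 4) M ℝ 2) (J : AlmostComplexStructure (𝓡 4) ∞ M)
      (K : Set M) (ψ : M → E4) (Φ : M ≃ₘ⟮𝓡 4, 𝓡 4⟯ E4),
      IsSmoothForm sf → IsClosedForm sf → IsCompact K →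
      (∀ x, x ∉ K → Φ x = ψ x) →
      (∀ x, x ∉ K → ∀ v w, sf x ![v, w] =
        stdSymplecticForm (mfderiv (𝓡 4) 𝓘(ℝ, E4) ψ x v) (mfderiv (𝓡 4) 𝓘(ℝ, E4) ψ x w)) →
      J.IsTamedBy sf →
      (∀ (x : M) (v : TangentSpace (𝓡 4) x), v ≠ 0 →
        0 < stdSymplecticForm (mfderiv (𝓡 4) 𝓘(ℝ, E4) Φ x v)
              (mfderiv (𝓡 4) 𝓘(ℝ, E4) Φ x (J x v))) →
      ∃ Φ' : M ≃ₘ⟮𝓡 4, 𝓡 4⟯ E4,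
        (∀ x v w, sf x ![v, w] =
          stdSymplecticForm (mfderiv (𝓡 4) 𝓘(ℝ, E4) Φ' x v) (mfderiv (𝓡 4) 𝓘(ℝ, E4) Φ' x w)) ∧
        ∃ K' : Set M, IsCompact K' ∧ ∀ x, x ∉ K' → Φ' x = ψ x := by
  intro M _ _ _ _ _ sf J K ψ Φ h2 h3 hK hΦψ h10 hJt htame
  have hn : (∞ : WithTop ℕ∞) ≠ 0 := by simp
  -- (0) `dψ = dΦ` off `K` (`K` is closed, `Φ = ψ` on the open `Kᶜ`), so `sf = Φ*ω₀` off `K`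
  have hKc : IsClosed K := hK.isClosed
  have hdψ : ∀ x, x ∉ K → mfderiv (𝓡 4) 𝓘(ℝ, E4) ψ x = mfderiv (𝓡 4) 𝓘(ℝ, E4) Φ x := by
    intro x hx
    refine Filter.EventuallyEq.mfderiv_eq ?_
    filter_upwards [hKc.isOpen_compl.mem_nhds hx] with z hz
    exact (hΦψ z hz).symm
  have h10' : ∀ x, x ∉ K → ∀ v w, sf x ![v, w] =
      stdSymplecticForm (mfderiv (𝓡 4) 𝓘(ℝ, E4) Φ x v) (mfderiv (𝓡 4) 𝓘(ℝ, E4) Φ x w) := by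
    intro x hx v w
    rw [h10 x hx v w, hdψ x hx]
    rfl
  -- (1) transport: `ω₁ = (Φ⁻¹)*sf` as a Mathlib form on `ℝ⁴`
  have hgs : ContMDiff (𝓡 4) (𝓡 4) ∞ (Φ.symm : E4 → M) := Φ.symm.contMDiff
  set ω₁ : E4 → E4 [⋀^Fin 2]→L[ℝ] ℝ := sf.pullback (𝓡 4) (Φ.symm : E4 → M) with hω₁
  have hω₁app : ∀ (y : E4) (a b : E4), ω₁ y ![a, b] = sf (Φ.symm y)
      ![mfderiv (𝓡 4) (𝓡 4) Φ.symm y a, mfderiv (𝓡 4) (𝓡 4) Φ.symm y b] := by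
    intro y a b
    have h1 := MForm.pullback_apply (I := 𝓡 4) (Φ.symm : E4 → M) sf y ![a, b]
    have h2 : (fun i ↦ mfderiv (𝓡 4) (𝓡 4) (Φ.symm : E4 → M) y (![a, b] i)) =
        ![mfderiv (𝓡 4) (𝓡 4) Φ.symm y a, mfderiv (𝓡 4) (𝓡 4) Φ.symm y b] := by
      funext i
      fin_cases i <;> rfl
    exact h1.trans (congrArg (sf (Φ.symm y)) h2)
  have hω₁s : ContDiff ℝ ∞ ω₁ :=
    contDiff_of_isSmoothForm_flat
      (Literature.NumberTheory.Transcendental.isSmoothForm_pullback hgs h2)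
  have hω₁d : extDeriv ω₁ = 0 := by
    refine extDeriv_eq_zero_of_isClosedForm_flat ?_
    show mextDeriv (sf.pullback (𝓡 4) (Φ.symm : E4 → M)) = 0
    rw [Literature.NumberTheory.Transcendental.mextDeriv_pullback hgs h2,
      show mextDeriv sf = 0 from h3, MForm.pullback_zero]
  -- the standard form as a constant Mathlib form
  set ω₀ : E4 → E4 [⋀^Fin 2]→L[ℝ] ℝ := fun _ ↦ stdSymplecticAlt with hω₀
  have hω₀s : ContDiff ℝ ∞ ω₀ := contDiff_const
  have hω₀d : extDeriv ω₀ = 0 := by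
    funext y
    simp only [hω₀, extDeriv, fderiv_fun_const, Pi.zero_apply,
      ← ContinuousAlternatingMap.alternatizeUncurryFinCLM_apply, map_zero]
  -- (2) `ω₁ = ω₀` off `Φ(K)`
  have hoff : ∀ y, Φ.symm y ∉ K → ω₁ y = ω₀ y := by
    intro y hy
    refine twoForm_ext fun a b ↦ ?_
    rw [hω₁app, h10' _ hy, mfderiv_apply_mfderiv_symm, mfderiv_apply_mfderiv_symm]
    simp only [hω₀, stdSymplecticAlt_apply]
  -- (3) `ω₀ − ω₁` has compact support and is closed, so `ω₀ − ω₁ = dβ`, `β` compactly supported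
  have hτc : HasCompactSupport fun y ↦ ω₀ y - ω₁ y := by
    refine HasCompactSupport.intro (hK.image Φ.continuous) fun y hy ↦ ?_
    have hgy : Φ.symm y ∉ K := fun h ↦ hy ⟨Φ.symm y, h, Φ.apply_symm_apply y⟩
    simp only [hoff y hgy, sub_self]
  have hτd : extDeriv (fun y ↦ ω₀ y - ω₁ y) = 0 := by
    funext y
    rw [extDeriv_fun_sub (hω₀s.differentiable hn y) (hω₁s.differentiable hn y), hω₀d, hω₁d]
    simp
  obtain ⟨β, hβs, hdβ, hβc⟩ :=
    exists_extDeriv_eq_hasCompactSupport' (hω₀s.sub hω₁s) hτd hτc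
  -- (4) the segment from `ω₁` to `ω₀` is nondegenerate: both tame the transported `J`
  have hnd : ∀ (y : E4) (t : ℝ), t ∈ Icc (0 : ℝ) 1 → ∀ v, v ≠ 0 →
      ∃ w, ((1 - t) • ω₁ y + t • ω₀ y) ![v, w] ≠ 0 := by
    intro y t ht v hv
    have hu0 : mfderiv (𝓡 4) (𝓡 4) Φ.symm y v ≠ 0 := by
      intro h0
      apply hv
      have h1 := mfderiv_apply_mfderiv_symm Φ y v
      rw [h0, map_zero] at h1
      exact h1.symm
    refine ⟨mfderiv (𝓡 4) (𝓡 4) Φ (Φ.symm y)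
      (J (Φ.symm y) (mfderiv (𝓡 4) (𝓡 4) Φ.symm y v)), ?_⟩
    have hω₁v : ω₁ y ![v, mfderiv (𝓡 4) (𝓡 4) Φ (Φ.symm y)
        (J (Φ.symm y) (mfderiv (𝓡 4) (𝓡 4) Φ.symm y v))] =
        sf (Φ.symm y) ![mfderiv (𝓡 4) (𝓡 4) Φ.symm y v,
          J (Φ.symm y) (mfderiv (𝓡 4) (𝓡 4) Φ.symm y v)] := by
      rw [hω₁app, mfderiv_symm_apply_mfderiv']
    have hω₀v : ω₀ y ![v, mfderiv (𝓡 4) (𝓡 4) Φ (Φ.symm y)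
        (J (Φ.symm y) (mfderiv (𝓡 4) (𝓡 4) Φ.symm y v))] =
        stdSymplecticForm v (mfderiv (𝓡 4) (𝓡 4) Φ (Φ.symm y)
          (J (Φ.symm y) (mfderiv (𝓡 4) (𝓡 4) Φ.symm y v))) := by
      simp only [hω₀, stdSymplecticAlt_apply]
    have hpos1 := hJt (Φ.symm y) (mfderiv (𝓡 4) (𝓡 4) Φ.symm y v) hu0
    have hpos0 := htame (Φ.symm y) (mfderiv (𝓡 4) (𝓡 4) Φ.symm y v) hu0
    rw [mfderiv_apply_mfderiv_symm] at hpos0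
    simp only [ContinuousAlternatingMap.add_apply, ContinuousAlternatingMap.smul_apply, hω₁v, hω₀v,
      smul_eq_mul]
    exact convex_comb_ne_zero hpos1 hpos0 ht.1 ht.2
  -- (5) Moser with compact support on `ℝ⁴`
  obtain ⟨ρ, hρ, R, hR⟩ :=
    moser_compactSupport hω₀s hω₁s hω₀d hω₁d hβs hβc (fun y ↦ congrFun hdβ y) hnd
  -- (6) `Φ' = ρ ∘ Φ`, `K' = K ∪ Φ⁻¹(B̄(0, R))`
  refine ⟨Φ.trans ρ, fun x v w ↦ ?_, K ∪ Φ.symm '' Metric.closedBall (0 : E4) R,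
    hK.union ((isCompact_closedBall (0 : E4) R).image Φ.symm.continuous), fun x hx ↦ ?_⟩
  · have hρd : MDifferentiableAt (𝓡 4) (𝓡 4) ρ (Φ x) := ρ.mdifferentiable hn (Φ x)
    have key := hρ (Φ x) (mfderiv (𝓡 4) (𝓡 4) Φ x v) (mfderiv (𝓡 4) (𝓡 4) Φ x w)
    simp only [hω₀, stdSymplecticAlt_apply] at key
    have key' : sf x ![v, w] = stdSymplecticForm (fderiv ℝ ρ (Φ x) (mfderiv (𝓡 4) (𝓡 4) Φ x v))
        (fderiv ℝ ρ (Φ x) (mfderiv (𝓡 4) (𝓡 4) Φ x w)) := by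
      rw [← key, hω₁app, mfderiv_symm_apply_mfderiv, mfderiv_symm_apply_mfderiv]
      exact (mform_apply_congr_point sf (Φ.symm_apply_apply x) v w).symm
    have hcomp : HasMFDerivAt (𝓡 4) (𝓡 4) ((ρ : E4 → E4) ∘ (Φ : M → E4)) x
        ((mfderiv (𝓡 4) (𝓡 4) ρ (Φ x)).comp (mfderiv (𝓡 4) (𝓡 4) Φ x)) :=
      hρd.hasMFDerivAt.comp x (Φ.mdifferentiable hn x).hasMFDerivAt
    have hfd : mfderiv (𝓡 4) 𝓘(ℝ, E4) (Φ.trans ρ) x =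
        (mfderiv (𝓡 4) (𝓡 4) ρ (Φ x)).comp (mfderiv (𝓡 4) (𝓡 4) Φ x) := by
      rw [Diffeomorph.coe_trans]
      exact hcomp.mfderiv
    have hpt : ∀ u : TangentSpace (𝓡 4) x, mfderiv (𝓡 4) 𝓘(ℝ, E4) (Φ.trans ρ) x u =
        fderiv ℝ ρ (Φ x) (mfderiv (𝓡 4) (𝓡 4) Φ x u) := by
      intro u
      rw [hfd]
      change mfderiv (𝓡 4) (𝓡 4) ρ (Φ x) (mfderiv (𝓡 4) (𝓡 4) Φ x u) = _
      rw [mfderiv_eq_fderiv]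
      rfl
    rw [hpt v, hpt w]
    exact key'
  · have hxK : x ∉ K := fun h ↦ hx (Or.inl h)
    have hΦx : R ≤ ‖Φ x‖ := by
      by_contra hlt
      apply hx
      refine Or.inr ⟨Φ x, ?_, Φ.symm_apply_apply x⟩
      rw [Metric.mem_closedBall, dist_zero_right]
      exact (not_le.1 hlt).le
    rw [Diffeomorph.coe_trans, Function.comp_apply, hR _ hΦx]
    exact hΦψ x hxK

end Summit.SmoothPoincare4.SmoothPoincare4.Theorems.GromovRecognitionRelEnd.CrossCapLaurent

end
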